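import Mathlib
import HarnessLib
import Summits.AtomisticToContinuum.Crystallization.Theorems.HolmgrenBoyleLindHalfSpaceUniqueContinuationThickColumnRigidity

/-!
# Route `HolmgrenBoyleLind`: Lennard-Jones force fields of separated sources, part 20d —
generic Bravais half-crystals with a rational facet normal are rigid

Support file for the crux item stmt-AtomisticToContinuum-6075 (`HalfSpaceUniqueContinuation`, line
`registered`, layered core; written by lead c3).

* **`hbl_lattice_eq_of_generic_halfSpace'`** (+ registered `∀`-form `hbl_lattice_eq_of_generic_halfSpace`) — for a full-rank lattice `L`
  with independent horizontal `s, t ∈ L` spanning a GENERIC layer lattice and a rational normal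
  (`λu ∈ L`, `λ > 0`), a separated balanced `s,t`-invariant set equal to `L` below a horizontal
  plane IS `L`; the thick lattice column below a lattice point feeds `hbl_thickColumn_rigidity'`
  (part 20c). No registration of the points above the plane (`hbl_lattice_eq_of_registered_halfSpace`)
  and no irrationality (`hbl_lattice_eq_of_irrational_halfSpace`) is assumed.
All `[folklore]`; nothing here closes an item.
-/

noncomputable section

namespace Summit.AtomisticToContinuum.Crystallization.Theorems.HolmgrenBoyleLind

open scoped BigOperators Topology InnerProductSpace RealInnerProductSpace

/-- **Generic Bravais half-crystals with a rational facet normal are rigid.** Let `L ⊂ ℝ³` be a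
full-rank lattice, `s, t ∈ L` independent and `⊥ u` (`‖u‖ = 1`) spanning a GENERIC layer lattice
(two horizontal vectors pairing integrally with `s, t` and of equal length are `±` each other), and
suppose the normal direction is rational: `λ u ∈ L` for some `λ > 0`. Then a `δ`-separated set in
exact Lennard-Jones force balance, invariant under `s` and `t`, that coincides with `L` on the open
half-space `{⟪z, u⟫ < a}` IS `L` — with NO registration hypothesis on its points above the plane
(compare `hbl_lattice_eq_of_registered_halfSpace`) and no irrationality (compare
`hbl_lattice_eq_of_irrational_halfSpace`): the lattice column below a lattice point is thick, and
`hbl_thickColumn_rigidity'` applies (`L` is separated and balanced by `hbl_lattice_hypotheses`).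
[folklore] -/
theorem hbl_lattice_eq_of_generic_halfSpace' (L : Submodule ℤ (EuclideanSpace ℝ (Fin 3)))
    [DiscreteTopology L] [IsZLattice ℝ L] {s t u : EuclideanSpace ℝ (Fin 3)} {a lam : ℝ}
    (hsL : s ∈ L) (htL : t ∈ L) (hlam : 0 < lam) (hlamL : lam • u ∈ L) (hu : ‖u‖ = 1) (ht0 : t ≠ 0)
    (hst : s ∉ Submodule.span ℝ ({t} : Set (EuclideanSpace ℝ (Fin 3))))
    (hsu : ⟪s, u⟫ = 0) (htu : ⟪t, u⟫ = 0)
    (hgen : ∀ w w' : EuclideanSpace ℝ (Fin 3), ⟪w, u⟫ = 0 → ⟪w', u⟫ = 0 →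
      (∃ m : ℤ, ⟪w, s⟫ = m) → (∃ m : ℤ, ⟪w, t⟫ = m) →
      (∃ m : ℤ, ⟪w', s⟫ = m) → (∃ m : ℤ, ⟪w', t⟫ = m) → ‖w'‖ = ‖w‖ → w' = w ∨ w' = -w)
    {ω : Set (EuclideanSpace ℝ (Fin 3))} {δ : ℝ} (hδ : 0 < δ)
    (hsep : ∀ x ∈ ω, ∀ y ∈ ω, x ≠ y → δ ≤ dist x y)
    (hbal : ∀ x ∈ ω, HasSum (fun y : {y : EuclideanSpace ℝ (Fin 3) // y ∈ ω ∧ y ≠ x} =>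
      (deriv Literature.MathematicalPhysics.StatisticalMechanics.lennardJones (dist x y) / dist x y) •
        (x - (y : EuclideanSpace ℝ (Fin 3)))) 0)
    (hωt : ∀ x : EuclideanSpace ℝ (Fin 3), x + t ∈ ω ↔ x ∈ ω)
    (hωs : ∀ x : EuclideanSpace ℝ (Fin 3), x + s ∈ ω ↔ x ∈ ω)
    (hagree : ∀ z : EuclideanSpace ℝ (Fin 3), ⟪z, u⟫ < a →
      (z ∈ ω ↔ z ∈ (L : Set (EuclideanSpace ℝ (Fin 3))))) :
    ω = (L : Set (EuclideanSpace ℝ (Fin 3))) := by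
  obtain ⟨δL, -, hδL, -, hsepL, -, -, hbalL⟩ := hbl_lattice_hypotheses L
  -- a common separation constant
  have hsep1 : ∀ x ∈ ω, ∀ y ∈ ω, x ≠ y → min δ δL ≤ dist x y :=
    fun x hx y hy hxy => (min_le_left _ _).trans (hsep x hx y hy hxy)
  have hsep2 : ∀ x ∈ (L : Set (EuclideanSpace ℝ (Fin 3))), ∀ y ∈ (L : Set (EuclideanSpace ℝ (Fin 3))),
      x ≠ y → min δ δL ≤ dist x y :=
    fun x hx y hy hxy => (min_le_right _ _).trans (hsepL x hx y hy hxy)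
  -- periods of `L`
  have hLt : ∀ x : EuclideanSpace ℝ (Fin 3), x + t ∈ (L : Set (EuclideanSpace ℝ (Fin 3))) ↔
      x ∈ (L : Set (EuclideanSpace ℝ (Fin 3))) := fun x =>
    ⟨fun h => by simpa using L.sub_mem h htL, fun h => L.add_mem h htL⟩
  have hLs : ∀ x : EuclideanSpace ℝ (Fin 3), x + s ∈ (L : Set (EuclideanSpace ℝ (Fin 3))) ↔
      x ∈ (L : Set (EuclideanSpace ℝ (Fin 3))) := fun x =>
    ⟨fun h => by simpa using L.sub_mem h hsL, fun h => L.add_mem h hsL⟩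
  have huu : ⟪u, u⟫ = 1 := by rw [real_inner_self_eq_norm_sq, hu, one_pow]
  -- multiples of the vertical lattice vector `lam • u`
  have hmul : ∀ m : ℕ, ((m : ℝ) * lam) • u ∈ (L : Set (EuclideanSpace ℝ (Fin 3))) := by
    intro m
    rw [mul_smul, Nat.cast_smul_eq_nsmul]
    exact L.toAddSubgroup.nsmul_mem hlamL m
  -- the top of the column: `x₀ = -(m₀ lam) u` with `-(m₀ lam) < a`
  obtain ⟨m₀, hm₀⟩ := exists_nat_gt ((|a| + 1) / lam)
  set x₀ : EuclideanSpace ℝ (Fin 3) := -(((m₀ : ℝ) * lam) • u) with hx₀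
  have hx₀a : ⟪x₀, u⟫ < a := by
    rw [hx₀, inner_neg_left, real_inner_smul_left, huu, mul_one]
    have h1 : |a| + 1 < (m₀ : ℝ) * lam := by rwa [div_lt_iff₀ hlam] at hm₀
    linarith [neg_abs_le a]
  -- the step: `M lam ≥ 1`
  obtain ⟨M, hM⟩ := exists_nat_gt (1 / lam)
  have hMlam : 1 < (M : ℝ) * lam := by rwa [div_lt_iff₀ hlam] at hM
  set tn : ℕ → ℝ := fun n => ((n : ℝ) + 1) * ((M : ℝ) * lam) with htn_def
  have hstep : 0 < (M : ℝ) * lam := by linarith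
  have htn : ∀ n, 1 ≤ tn n := by
    intro n
    simp only [htn_def]
    have hn : (1 : ℝ) ≤ (n : ℝ) + 1 := by
      have := (Nat.cast_nonneg n : (0 : ℝ) ≤ n); linarith
    nlinarith
  have hinj : Function.Injective tn := by
    intro m n h
    simp only [htn_def] at h
    have h' := mul_right_cancel₀ hstep.ne' h
    exact_mod_cast (by linarith : (m : ℝ) = n)
  have hns : ¬ Summable (fun n => (tn n)⁻¹) := by
    intro h
    have hM0 : (M : ℝ) ≠ 0 := by
      rintro hM0; rw [hM0, zero_mul] at hMlam; linarith
    have h2 : Summable (fun n : ℕ => ((n : ℝ) + 1)⁻¹) := by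
      have h1 := h.mul_left ((M : ℝ) * lam)
      refine h1.congr fun n => ?_
      simp only [htn_def, mul_inv]
      field_simp
    have h3 : Summable (fun n : ℕ => ((n + 1 : ℕ) : ℝ)⁻¹) :=
      h2.congr fun n => by push_cast; rfl
    exact Real.not_summable_natCast_inv
      ((summable_nat_add_iff (f := fun n : ℕ => ((n : ℕ) : ℝ)⁻¹) 1).1 h3)
  have hcolω : ∀ n, x₀ - tn n • u ∈ ω := by
    intro n
    have hmem : x₀ - tn n • u ∈ (L : Set (EuclideanSpace ℝ (Fin 3))) := by
      have h1 : x₀ - tn n • u = -((((m₀ + (n + 1) * M : ℕ) : ℝ) * lam) • u) := by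
        rw [hx₀, htn_def]
        push_cast
        rw [← neg_add', ← add_smul]
        congr 2
        ring
      rw [h1]
      exact L.neg_mem (hmul _)
    have hlt : ⟪x₀ - tn n • u, u⟫ < a := by
      rw [inner_sub_left, real_inner_smul_left, huu, mul_one]
      linarith [htn n]
    exact (hagree _ hlt).2 hmem
  exact hbl_thickColumn_rigidity' (lt_min hδ hδL) hsep1 hsep2 hbal hbalL hu ht0 hst hsu htu hωt hωs
    hLt hLs hagree hgen hx₀a htn hinj hns hcolω

/-- **Generic Bravais half-crystals with a rational facet normal are rigid** (registered
`∀`-form of `hbl_lattice_eq_of_generic_halfSpace'`). [folklore] -/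
theorem hbl_lattice_eq_of_generic_halfSpace : ∀ (L : Submodule ℤ (EuclideanSpace ℝ (Fin 3))) [DiscreteTopology L] [IsZLattice ℝ L] {s t u : EuclideanSpace ℝ (Fin 3)} {a lam : ℝ}, s ∈ L → t ∈ L → 0 < lam → lam • u ∈ L → ‖u‖ = 1 → t ≠ 0 → s ∉ Submodule.span ℝ ({t} : Set (EuclideanSpace ℝ (Fin 3))) → inner ℝ s u = 0 → inner ℝ t u = 0 → (∀ w w' : EuclideanSpace ℝ (Fin 3), inner ℝ w u = 0 → inner ℝ w' u = 0 → (∃ m : ℤ, inner ℝ w s = m) → (∃ m : ℤ, inner ℝ w t = m) → (∃ m : ℤ, inner ℝ w' s = m) → (∃ m : ℤ, inner ℝ w' t = m) → ‖w'‖ = ‖w‖ → w' = w ∨ w' = -w) → ∀ {ω : Set (EuclideanSpace ℝ (Fin 3))} {δ : ℝ}, 0 < δ → (∀ x ∈ ω, ∀ y ∈ ω, x ≠ y → δ ≤ dist x y) → (∀ x ∈ ω, HasSum (fun y : {y : EuclideanSpace ℝ (Fin 3) // y ∈ ω ∧ y ≠ x} => (deriv Literature.MathematicalPhysics.StatisticalMechanics.lennardJones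 (dist x y) / dist x y) • (x - (y : EuclideanSpace ℝ (Fin 3)))) 0) → (∀ x : EuclideanSpace ℝ (Fin 3), x + t ∈ ω ↔ x ∈ ω) → (∀ x : EuclideanSpace ℝ (Fin 3), x + s ∈ ω ↔ x ∈ ω) → (∀ z : EuclideanSpace ℝ (Fin 3), inner ℝ z u < a → (z ∈ ω ↔ z ∈ (L : Set (EuclideanSpace ℝ (Fin 3))))) → ω = (L : Set (EuclideanSpace ℝ (Fin 3))) := by
  intro L _ _ s t u a lam hsL htL hlam hlamL hu ht0 hst hsu htu hgen ω δ hδ hsep hbal hωt hωs hagree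
  exact hbl_lattice_eq_of_generic_halfSpace' L hsL htL hlam hlamL hu ht0 hst hsu htu hgen hδ hsep hbal
    hωt hωs hagree

end Summit.AtomisticToContinuum.Crystallization.Theorems.HolmgrenBoyleLind

end
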